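import Literature.Geometry.Lorentzian.ConicBogovskiiKernel
import Literature.Geometry.Lorentzian.LinearConstraintMoments
import Literature.Analysis.FluidPDE.SphereIntegral
import Mathlib.Analysis.SpecialFunctions.Pow.Integral
import Mathlib.MeasureTheory.Integral.IntegralEqImproper
import Mathlib.MeasureTheory.Measure.Lebesgue.VolumeOfBalls
import HarnessLib

/-!
# The conic Bogovskiĭ kernel at the origin: `Σ_i ∂_i (κ zⁱ/|z|³) = (∫_{S²} κ) δ₀`

(trunk G08 = T-LORENTZ; family `gr`; namespace `Literature.Geometry.Lorentzian.MaoOhTao`.)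

Mao–Oh–Tao (arXiv:2308.13031), Remark 2.6 verifies property (S_c2) of the conic solution operator of Lemma 2.5,
`∂_i ∂_j (S_c f)^{ij} = f`, by the distributional computation

  `∂_i ∂_j (κ zⁱ zʲ/|z|³) = ∂_i (κ zⁱ/|z|³) = δ₀`   (`κ = κ(z/|z|)`, `∫_{S²} κ = 1`).

`ConicBogovskiiKernel.lean` proves the pointwise part on `ℝ³ ∖ {0}`.  This file proves the identity AT THE ORIGIN in
its weak form: for a profile `κ` continuous and `0`-homogeneous off the origin and a test function `φ ∈ C¹_c(ℝ³)`,

  `∫ κ(z) |z|⁻³ Dφ(z)·z dz = −φ(0) ∫_{S²} κ dσ`      (`integral_kernel_fderiv_apply_self_eq`),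

i.e. `⟨Σ_i ∂_i(κ zⁱ/|z|³), φ⟩ := −Σ_i ∫ κ zⁱ/|z|³ ∂_iφ = (∫_{S²} κ dσ) φ(0)` (`sum_integral_kernel_coord_pd_eq`), so that
`Σ_i ∂_i (κ zⁱ/|z|³) = δ₀` exactly when `∫_{S²} κ dσ = 1` (`integral_kernel_fderiv_apply_self_eq_neg`); here `σ` is
the surface measure of the unit sphere (`volume.toSphere`, total mass `4π`, `volume_toSphere_univ`), and for `κ ≡ 1`
this is the Newtonian identity `div (z/|z|³) = 4π δ₀` (`integral_inv_norm_cube_fderiv_apply_self_eq`).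

Proof (polar coordinates, as in the classical computation): `|z|⁻³ Dφ(z)·z = |z|⁻² ∂_r φ`, so by
`Literature.Analysis.FluidPDE.integral_eq_integral_Ioi_sphereIntegral` the left-hand side is
`∫_0^∞ (d/dr) ∫_{S²} κ(α) φ(rα) dσ(α) dr = −φ(0) ∫_{S²} κ` (differentiation of weighted sphere integrals under the
integral sign, `hasDerivAt_integral_weight_mul`, and the fundamental theorem of calculus on `(0, ∞)` for the compactly
supported radial profile).  The integrand is `O(|z|⁻²)` near the origin, hence integrable on `ℝ³`
(`integrable_kernel_mul`, Mathlib's `integrableOn_ball_of_norm_le_rpow`).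

The second half of (S_c2) follows by one more radial integration by parts against the `O(|z|⁻¹)` kernel
`K^{ij}_κ = κ zⁱzʲ/|z|³`: for `ψ ∈ C²_c(ℝ³)`,

  `Σ_{i,j} ∫ κ(z) zᵢ zⱼ |z|⁻³ ∂ⱼ∂ᵢψ(z) dz = ψ(0) ∫_{S²} κ dσ`   (`sum_sum_integral_conicKernel_pd_pd_eq`),

(`Σ_j K^{ij}_κ ∂_j g = κ αᵢ |z|⁻¹ ∂_r g` in polar coordinates, `∫_0^∞ r H' = −∫_0^∞ H`,
`integral_Ioi_mul_deriv_eq_neg_integral`), and in convolution form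
`Σ_{i,j} ∫ K^{ij}_κ(z) (∂ⱼ∂ᵢ f)(x − z) dz = f(x) ∫_{S²} κ` (`sum_sum_integral_conicKernel_pd_pd_sub_eq`; `= f(x)`
for a normalised profile, `…_eq_self`): the double divergence of `S_c f = K_κ ⋆ f`, derivatives on `f`, is `f`.

Everything is proved; no definitions, no named facts.  Not treated here: moving the derivatives from `f` onto the
convolution `K_κ ⋆ f` (differentiation under the integral sign) and the weighted Sobolev bounds (S_c3).

## References

* Y. Mao, S.-J. Oh, T. Tao, *Initial data gluing in the asymptotically flat regime via solution operators with
  prescribed support properties*, arXiv:2308.13031 (2023), Lemma 2.5 (S_c2) and Remark 2.6 (key `MaoOhTao2023`).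
* L. C. Evans, *Partial differential equations*, 2nd ed. (2010), §2.2.1 (the fundamental solution of the Laplacian;
  the same polar-coordinates computation for `κ ≡ 1`).
-/

noncomputable section

open scoped RealInnerProductSpace Topology ContDiff
open Filter MeasureTheory Set Metric Function
open Literature.Analysis.FluidPDE

namespace Literature.Geometry.Lorentzian

namespace MaoOhTao

/-! ### Weighted sphere integrals `r ↦ ∫ w(α) φ(rα) dσ(α)` -/

section WeightedSphere

variable {w : sphere (0 : E3) 1 → ℝ} {φ : E3 → ℝ}

/-- On the unit sphere `‖ρ • α‖ = |ρ|`. [folklore] -/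
theorem norm_smul_unitSphere (ρ : ℝ) (α : sphere (0 : E3) 1) : ‖ρ • (α : E3)‖ = |ρ| := by
  rw [norm_smul, norm_eq_of_mem_sphere α, mul_one, Real.norm_eq_abs]

/-- **Differentiating a weighted sphere integral in the radius.** For a continuous weight `w` on the unit sphere
and `φ ∈ C¹(ℝ³)`, `d/dr ∫ w(α) φ(rα) dσ(α) = ∫ w(α) Dφ(rα)·α dσ(α)` at every `r` (differentiation under the
integral sign over the finite surface measure, dominated by `sup |w| · sup_{B} |Dφ|`; the weighted form of
`Literature.Analysis.FluidPDE.hasDerivAt_sphereIntegral`). [folklore] -/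
theorem hasDerivAt_integral_weight_mul (hw : Continuous w) (hφ : ContDiff ℝ 1 φ) (r : ℝ) :
    HasDerivAt (fun ρ : ℝ ↦ ∫ α, w α * φ (ρ • (α : E3)) ∂(volume : Measure E3).toSphere)
      (∫ α, w α * fderiv ℝ φ (r • (α : E3)) (α : E3) ∂(volume : Measure E3).toSphere) r := by
  have hfd : Differentiable ℝ φ := hφ.differentiable one_ne_zero
  have hfc : Continuous (fderiv ℝ φ) := hφ.continuous_fderiv one_ne_zero
  obtain ⟨C, hC⟩ := (isCompact_closedBall (0 : E3) (|r| + 1)).exists_bound_of_continuousOn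
    hfc.continuousOn
  obtain ⟨W, hW⟩ := isCompact_univ.exists_bound_of_continuousOn hw.continuousOn
  have hs : Ioo (r - 1) (r + 1) ∈ 𝓝 r := Ioo_mem_nhds (by linarith) (by linarith)
  have hslice : ∀ ρ : ℝ, Continuous fun α : sphere (0 : E3) 1 ↦ w α * φ (ρ • (α : E3)) := fun ρ ↦
    hw.mul (hφ.continuous.comp (continuous_subtype_val.const_smul ρ))
  have hslice' : ∀ ρ : ℝ, Continuous fun α : sphere (0 : E3) 1 ↦
      w α * fderiv ℝ φ (ρ • (α : E3)) (α : E3) := fun ρ ↦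
    hw.mul ((hfc.comp (continuous_subtype_val.const_smul ρ)).clm_apply
      continuous_subtype_val)
  have hint : ∀ ρ : ℝ, Integrable (fun α : sphere (0 : E3) 1 ↦ w α * φ (ρ • (α : E3)))
      (volume : Measure E3).toSphere := fun ρ ↦
    integrableOn_univ.1 ((hslice ρ).continuousOn.integrableOn_compact isCompact_univ)
  refine (hasDerivAt_integral_of_dominated_loc_of_deriv_le (μ := (volume : Measure E3).toSphere)
    (F := fun (ρ : ℝ) (α : sphere (0 : E3) 1) ↦ w α * φ (ρ • (α : E3)))
    (F' := fun (ρ : ℝ) (α : sphere (0 : E3) 1) ↦ w α * fderiv ℝ φ (ρ • (α : E3)) (α : E3))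
    (bound := fun _ ↦ max W 0 * max C 0) hs
    (Eventually.of_forall fun ρ ↦ (hslice ρ).aestronglyMeasurable) (hint r)
    (hslice' r).aestronglyMeasurable ?_ (integrable_const _) ?_).2
  · refine ae_of_all _ fun α ρ hρ ↦ ?_
    have hmem : ρ • (α : E3) ∈ closedBall (0 : E3) (|r| + 1) := by
      rw [mem_closedBall, dist_zero_right, norm_smul_unitSphere]
      have h1 := hρ.1
      have h2 := hρ.2
      rw [abs_le]
      constructor <;> [linarith [neg_abs_le r, le_abs_self r]; linarith [le_abs_self r]]
    rw [Real.norm_eq_abs, abs_mul]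
    have h1 : |fderiv ℝ φ (ρ • (α : E3)) (α : E3)| ≤ max C 0 := by
      calc |fderiv ℝ φ (ρ • (α : E3)) (α : E3)|
          ≤ ‖fderiv ℝ φ (ρ • (α : E3))‖ * ‖(α : E3)‖ := by
            rw [← Real.norm_eq_abs]; exact ContinuousLinearMap.le_opNorm _ _
        _ ≤ max C 0 := by
            rw [norm_eq_of_mem_sphere α, mul_one]
            exact (hC _ hmem).trans (le_max_left _ _)
    have h2 : |w α| ≤ max W 0 := by
      rw [← Real.norm_eq_abs]; exact (hW α (mem_univ _)).trans (le_max_left _ _)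
    exact mul_le_mul h2 h1 (abs_nonneg _) (le_max_right _ _)
  · refine ae_of_all _ fun α ρ _ ↦ ?_
    have h1 : HasDerivAt (fun ρ : ℝ ↦ ρ • (α : E3)) ((1 : ℝ) • (α : E3)) ρ :=
      (hasDerivAt_id ρ).smul_const (α : E3)
    rw [one_smul] at h1
    exact ((hfd (ρ • (α : E3))).hasFDerivAt.comp_hasDerivAt ρ h1).const_mul (w α)

/-- The derivative `r ↦ ∫ w(α) Dφ(rα)·α dσ(α)` of a weighted sphere integral is continuous in the radius
(parametric integral of a jointly continuous integrand over the compact sphere). [folklore] -/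
theorem continuous_integral_weight_mul_fderiv (hw : Continuous w) (hφ : ContDiff ℝ 1 φ) :
    Continuous fun ρ : ℝ ↦
      ∫ α, w α * fderiv ℝ φ (ρ • (α : E3)) (α : E3) ∂(volume : Measure E3).toSphere := by
  have hF : Continuous (uncurry fun (ρ : ℝ) (α : sphere (0 : E3) 1) ↦
      w α * fderiv ℝ φ (ρ • (α : E3)) (α : E3)) :=
    (hw.comp continuous_snd).mul ((((hφ.continuous_fderiv one_ne_zero).comp
      (continuous_fst.smul (continuous_subtype_val.comp continuous_snd))).clm_apply
      (continuous_subtype_val.comp continuous_snd)))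
  have h := continuous_parametric_integral_of_continuous (μ := (volume : Measure E3).toSphere) hF
    isCompact_univ
  simp only [Measure.restrict_univ] at h
  exact h

/-- At radius `0` the weighted sphere integral is `φ(0) ∫ w dσ`. [folklore] -/
theorem integral_weight_mul_zero_smul (w : sphere (0 : E3) 1 → ℝ) (φ : E3 → ℝ) :
    (∫ α, w α * φ ((0 : ℝ) • (α : E3)) ∂(volume : Measure E3).toSphere) =
      φ 0 * ∫ α, w α ∂(volume : Measure E3).toSphere := by
  simp only [zero_smul, integral_mul_const]
  ring

/-- A function vanishes outside any closed ball containing its topological support. [folklore] -/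
theorem eq_zero_of_lt_norm {R : ℝ} (hR : tsupport φ ⊆ closedBall (0 : E3) R) {z : E3} (hz : R < ‖z‖) :
    φ z = 0 :=
  image_eq_zero_of_notMem_tsupport fun h ↦ by
    have := hR h
    rw [mem_closedBall, dist_zero_right] at this
    linarith

/-- The derivative vanishes outside any closed ball containing the topological support. [folklore] -/
theorem fderiv_eq_zero_of_lt_norm {R : ℝ} (hR : tsupport φ ⊆ closedBall (0 : E3) R) {z : E3}
    (hz : R < ‖z‖) : fderiv ℝ φ z = 0 :=
  image_eq_zero_of_notMem_tsupport fun h ↦ by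
    have := hR (tsupport_fderiv_subset ℝ h)
    rw [mem_closedBall, dist_zero_right] at this
    linarith

/-- **The radial integral of the derivative of a weighted sphere integral.** For a continuous weight `w` on the
unit sphere and `φ ∈ C¹_c(ℝ³)`,
`∫_0^∞ (∫ w(α) Dφ(rα)·α dσ(α)) dr = −φ(0) ∫ w dσ`
(fundamental theorem of calculus on `(0, ∞)` for `G(r) = ∫ w(α) φ(rα) dσ(α)`, which is differentiable with the
stated derivative (`hasDerivAt_integral_weight_mul`), vanishes for large `r` and equals `φ(0) ∫ w` at `r = 0`).
[folklore] -/
theorem integral_Ioi_integral_weight_mul_fderiv (hw : Continuous w) (hφ : ContDiff ℝ 1 φ)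
    (hφc : HasCompactSupport φ) :
    ∫ r in Ioi (0 : ℝ), (∫ α, w α * fderiv ℝ φ (r • (α : E3)) (α : E3) ∂(volume : Measure E3).toSphere) =
      -(φ 0 * ∫ α, w α ∂(volume : Measure E3).toSphere) := by
  obtain ⟨R, hR⟩ := hφc.isCompact.isBounded.subset_closedBall 0
  set G : ℝ → ℝ := fun ρ ↦ ∫ α, w α * φ (ρ • (α : E3)) ∂(volume : Measure E3).toSphere with hGdef
  set G' : ℝ → ℝ := fun ρ ↦
    ∫ α, w α * fderiv ℝ φ (ρ • (α : E3)) (α : E3) ∂(volume : Measure E3).toSphere with hG'def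
  have hG : ∀ ρ, HasDerivAt G (G' ρ) ρ := fun ρ ↦ hasDerivAt_integral_weight_mul hw hφ ρ
  have hG0 : ∀ ρ : ℝ, R < |ρ| → G ρ = 0 := fun ρ hρ ↦ by
    have h : ∀ α : sphere (0 : E3) 1, φ (ρ • (α : E3)) = 0 := fun α ↦
      eq_zero_of_lt_norm hR (by rw [norm_smul_unitSphere]; exact hρ)
    simp [hGdef, h]
  have hG'0 : ∀ ρ : ℝ, R < |ρ| → G' ρ = 0 := fun ρ hρ ↦ by
    have h : ∀ α : sphere (0 : E3) 1, fderiv ℝ φ (ρ • (α : E3)) = 0 := fun α ↦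
      fderiv_eq_zero_of_lt_norm hR (by rw [norm_smul_unitSphere]; exact hρ)
    simp [hG'def, h]
  have hG'c : Continuous G' := continuous_integral_weight_mul_fderiv hw hφ
  have hG'supp : HasCompactSupport G' := by
    refine HasCompactSupport.intro (isCompact_closedBall (0 : ℝ) R) fun ρ hρ ↦ hG'0 ρ ?_
    rwa [mem_closedBall, dist_zero_right, Real.norm_eq_abs, not_le] at hρ
  have hint : IntegrableOn G' (Ioi 0) := (hG'c.integrable_of_hasCompactSupport hG'supp).integrableOn
  have htends : Tendsto G atTop (𝓝 0) := by
    refine tendsto_const_nhds.congr' ?_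
    filter_upwards [eventually_gt_atTop (max R 0)] with ρ hρ
    have hρ0 : 0 < ρ := lt_of_le_of_lt (le_max_right _ _) hρ
    exact (hG0 ρ (by rw [abs_of_pos hρ0]; exact lt_of_le_of_lt (le_max_left _ _) hρ)).symm
  have key := integral_Ioi_of_hasDerivAt_of_tendsto (hG 0).continuousAt.continuousWithinAt
    (fun ρ _ ↦ hG ρ) hint htends
  rw [key, zero_sub, hGdef]
  simp only [integral_weight_mul_zero_smul]

end WeightedSphere

/-! ### The surface measure of the unit sphere of `ℝ³` -/

/-- The surface measure `σ = volume.toSphere` of the unit sphere of `ℝ³` has total mass `4π` (`σ(S²) = 3 · |B₁|`,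
`|B₁| = 4π/3`). [folklore] -/
theorem volume_toSphere_univ : (volume : Measure E3).toSphere univ = ENNReal.ofReal (4 * Real.pi) := by
  rw [Measure.toSphere_apply_univ, finrank_euclideanSpace_fin, EuclideanSpace.volume_ball_fin_three]
  rw [ENNReal.ofReal_one, one_pow, one_mul, show ((3 : ℕ) : ENNReal) = ENNReal.ofReal 3 by simp,
    ← ENNReal.ofReal_mul (by norm_num)]
  congr 1
  ring

/-- Real form: `σ(S²) = 4π`. [folklore] -/
theorem volume_toSphere_real_univ : (volume : Measure E3).toSphere.real univ = 4 * Real.pi := by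
  rw [Measure.real, volume_toSphere_univ, ENNReal.toReal_ofReal (by positivity)]

/-! ### The pairing `∫ κ |z|⁻³ Dφ(z)·z dz` -/

section Origin

variable {κ φ : E3 → ℝ}

/-- A profile continuous off the origin restricts to a continuous weight on the unit sphere. [folklore] -/
theorem continuous_sphere_restrict (hκ : ContinuousOn κ {0}ᶜ) :
    Continuous fun α : sphere (0 : E3) 1 ↦ κ (α : E3) :=
  hκ.comp_continuous continuous_subtype_val fun α ↦
    mem_compl_singleton_iff.2 (ne_zero_of_mem_unit_sphere α)

/-- A profile continuous and `0`-homogeneous off the origin is bounded off the origin (by its maximum on the compact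
unit sphere). [folklore] -/
theorem exists_abs_le_of_homogeneous (hκ : ContinuousOn κ {0}ᶜ)
    (hhom : ∀ y : E3, y ≠ 0 → ∀ t : ℝ, 0 < t → κ (t • y) = κ y) :
    ∃ W, ∀ z : E3, z ≠ 0 → |κ z| ≤ W := by
  obtain ⟨W, hW⟩ := isCompact_univ.exists_bound_of_continuousOn
    (continuous_sphere_restrict hκ).continuousOn
  refine ⟨W, fun z hz ↦ ?_⟩
  have hn : 0 < ‖z‖ := norm_pos_iff.2 hz
  have hmem : ‖z‖⁻¹ • z ∈ sphere (0 : E3) 1 := by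
    rw [mem_sphere_zero_iff_norm, norm_smul, norm_inv, norm_norm, inv_mul_cancel₀ hn.ne']
  have h := hW ⟨‖z‖⁻¹ • z, hmem⟩ (mem_univ _)
  rw [Real.norm_eq_abs] at h
  simpa [hhom z hz ‖z‖⁻¹ (inv_pos.2 hn)] using h

/-- `|zᵢ| ≤ |z|` (a private copy of a FluidPDE helper). [folklore] -/
private theorem abs_apply_le_norm (v : E3) (i : Fin 3) : |v i| ≤ ‖v‖ := by
  simpa using PiLp.norm_apply_le v i

/-- **Integrability of the singular pairings, general form.** For `κ` continuous and `0`-homogeneous off the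
origin and a continuous, compactly supported factor `q` with `|q(z)| ≤ C |z|`, the function `κ(z) |z|⁻³ q(z)` is
integrable on `ℝ³`: it is `O(|z|⁻²)` near the origin (Mathlib's `integrableOn_ball_of_norm_le_rpow`). [folklore] -/
theorem integrable_kernel_mul_of_le (hκ : ContinuousOn κ {0}ᶜ)
    (hhom : ∀ y : E3, y ≠ 0 → ∀ t : ℝ, 0 < t → κ (t • y) = κ y) {q : E3 → ℝ} (hq : Continuous q)
    (hqc : HasCompactSupport q) {C : ℝ} (hqb : ∀ z, |q z| ≤ C * ‖z‖) :
    Integrable fun z : E3 ↦ κ z * ((‖z‖ ^ 3)⁻¹ * q z) := by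
  obtain ⟨R, hR⟩ := hqc.isCompact.isBounded.subset_closedBall 0
  obtain ⟨W, hW⟩ := exists_abs_le_of_homogeneous hκ hhom
  set F : E3 → ℝ := fun z ↦ κ z * ((‖z‖ ^ 3)⁻¹ * q z) with hFdef
  -- support in a ball
  have hsupp : support F ⊆ ball (0 : E3) (R + 1) := by
    intro z hz
    rw [mem_ball_zero_iff]
    by_contra h
    have hz' : R < ‖z‖ := by linarith [not_lt.1 h]
    have hq0 : q z = 0 := eq_zero_of_lt_norm hR hz'
    exact hz (by simp [hFdef, hq0])
  rw [← integrableOn_iff_integrable_of_support_subset hsupp]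
  -- measurability (continuity off the origin, a null set)
  have hcont : ContinuousOn F {0}ᶜ := by
    refine hκ.mul ((ContinuousOn.inv₀ ((continuous_norm.pow 3).continuousOn) fun z hz ↦ ?_).mul
      hq.continuousOn)
    exact pow_ne_zero 3 (norm_ne_zero_iff.2 (mem_compl_singleton_iff.1 hz))
  have hmeas : AEStronglyMeasurable F (volume : Measure E3) := by
    have h := hcont.aestronglyMeasurable (μ := (volume : Measure E3))
      (measurableSet_singleton (0 : E3)).compl
    rwa [restrict_compl_singleton] at h
  refine integrableOn_ball_of_norm_le_rpow (by rw [finrank_euclideanSpace_fin]; norm_num)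
    (C := W * max C 0) (α := 2) (by rw [finrank_euclideanSpace_fin]; norm_num)
    (Eventually.of_forall fun z ↦ ?_) hmeas
  -- the decay bound `|F z| ≤ W C |z|⁻²`
  by_cases hz : z = 0
  · subst hz
    have h0 : F 0 = 0 := by simp [hFdef]
    simp only [h0, norm_zero, Real.zero_rpow (show (-(2 : ℝ)) ≠ 0 by norm_num), mul_zero, le_refl]
  · have hn : 0 < ‖z‖ := norm_pos_iff.2 hz
    have hW0 : 0 ≤ W := (abs_nonneg _).trans (hW z hz)
    have hrpow : ‖z‖ ^ (-(2 : ℝ)) = (‖z‖ ^ 2)⁻¹ := by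
      rw [Real.rpow_neg hn.le, Real.rpow_two]
    rw [Real.norm_eq_abs, hrpow, hFdef]
    simp only [abs_mul, abs_inv, abs_pow, abs_norm]
    have hqz : |q z| ≤ max C 0 * ‖z‖ :=
      (hqb z).trans (mul_le_mul_of_nonneg_right (le_max_left _ _) hn.le)
    calc |κ z| * ((‖z‖ ^ 3)⁻¹ * |q z|) ≤ W * ((‖z‖ ^ 3)⁻¹ * (max C 0 * ‖z‖)) :=
          mul_le_mul (hW z hz) (mul_le_mul_of_nonneg_left hqz (by positivity)) (by positivity) hW0
      _ = W * max C 0 * (‖z‖ ^ 2)⁻¹ := by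
          field_simp

/-- **Integrability of the singular pairings.** For `κ` continuous and `0`-homogeneous off the origin, `φ ∈ C¹_c`,
and a continuous factor `q` with `|q(z)| ≤ |z| ‖Dφ(z)‖` (e.g. `Dφ(z)·z`, `zᵢ ∂ᵢφ(z)`), the function
`κ(z) |z|⁻³ q(z)` is integrable on `ℝ³`: it is `O(|z|⁻²)` near the origin and compactly supported
(Mathlib's `integrableOn_ball_of_norm_le_rpow`). [folklore] -/
theorem integrable_kernel_mul (hκ : ContinuousOn κ {0}ᶜ)
    (hhom : ∀ y : E3, y ≠ 0 → ∀ t : ℝ, 0 < t → κ (t • y) = κ y) (hφ : ContDiff ℝ 1 φ)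
    (hφc : HasCompactSupport φ) {q : E3 → ℝ} (hq : Continuous q)
    (hqb : ∀ z, |q z| ≤ ‖z‖ * ‖fderiv ℝ φ z‖) :
    Integrable fun z : E3 ↦ κ z * ((‖z‖ ^ 3)⁻¹ * q z) := by
  obtain ⟨M, hM⟩ := (hφ.continuous_fderiv one_ne_zero).bounded_above_of_compact_support
    (hφc.fderiv (𝕜 := ℝ))
  have hqc : HasCompactSupport q := by
    refine (hφc.fderiv (𝕜 := ℝ)).mono (support_subset_iff'.2 fun z hz ↦ ?_)
    have h0 : fderiv ℝ φ z = 0 := notMem_support.1 hz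
    have := hqb z
    rw [h0, norm_zero, mul_zero] at this
    exact abs_nonpos_iff.1 this
  refine integrable_kernel_mul_of_le hκ hhom hq hqc (C := M) fun z ↦ (hqb z).trans ?_
  rw [mul_comm]
  exact mul_le_mul_of_nonneg_right (hM z) (norm_nonneg _)

/-- `Dφ(x)·v = Σ_i vᵢ ∂ᵢφ(x)` (expand `v` in the coordinate frame). [folklore] -/
theorem fderiv_apply_eq_sum (φ : E3 → ℝ) (x v : E3) : fderiv ℝ φ x v = ∑ i, v i * pd i φ x := by
  have hv : ∑ i, v i • e i = v := by
    simpa [e] using (EuclideanSpace.basisFun (Fin 3) ℝ).sum_repr v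
  calc fderiv ℝ φ x v = fderiv ℝ φ x (∑ i, v i • e i) := by rw [hv]
    _ = ∑ i, v i * pd i φ x := by simp [map_sum, map_smul, pd]

/-- `Dφ(z)·z = Σ_i zᵢ ∂ᵢφ(z)`. [folklore] -/
theorem fderiv_apply_self_eq_sum (φ : E3 → ℝ) (z : E3) : fderiv ℝ φ z z = ∑ i, z i * pd i φ z :=
  fderiv_apply_eq_sum φ z z

/-- The integrand `κ |z|⁻³ Dφ(z)·z` is integrable. [folklore] -/
theorem integrable_kernel_fderiv_apply_self (hκ : ContinuousOn κ {0}ᶜ)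
    (hhom : ∀ y : E3, y ≠ 0 → ∀ t : ℝ, 0 < t → κ (t • y) = κ y) (hφ : ContDiff ℝ 1 φ)
    (hφc : HasCompactSupport φ) :
    Integrable fun z : E3 ↦ κ z * ((‖z‖ ^ 3)⁻¹ * fderiv ℝ φ z z) :=
  integrable_kernel_mul hκ hhom hφ hφc
    (((hφ.continuous_fderiv one_ne_zero).clm_apply continuous_id)) fun z ↦ by
      rw [← Real.norm_eq_abs, mul_comm]
      exact ContinuousLinearMap.le_opNorm _ _

/-- **Polar form of the pairing.** For `κ` continuous and `0`-homogeneous off the origin and `φ ∈ C¹_c(ℝ³)`,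
`∫ κ(z) |z|⁻³ Dφ(z)·z dz = ∫_0^∞ ∫_{S²} κ(α) Dφ(rα)·α dσ(α) dr` (polar coordinates; the Jacobian `r²` cancels the
homogeneity `|z|⁻³ · z`). [folklore] -/
theorem integral_kernel_fderiv_apply_self_eq_integral_Ioi (hκ : ContinuousOn κ {0}ᶜ)
    (hhom : ∀ y : E3, y ≠ 0 → ∀ t : ℝ, 0 < t → κ (t • y) = κ y) (hφ : ContDiff ℝ 1 φ)
    (hφc : HasCompactSupport φ) :
    ∫ z : E3, κ z * ((‖z‖ ^ 3)⁻¹ * fderiv ℝ φ z z) =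
      ∫ r in Ioi (0 : ℝ), ∫ α, κ (α : E3) * fderiv ℝ φ (r • (α : E3)) (α : E3)
        ∂(volume : Measure E3).toSphere := by
  rw [integral_eq_integral_Ioi_sphereIntegral (volume : Measure E3)
    (integrable_kernel_fderiv_apply_self hκ hhom hφ hφc)]
  refine setIntegral_congr_fun measurableSet_Ioi fun r hr ↦ ?_
  have hr0 : (0 : ℝ) < r := hr
  have hdim : Module.finrank ℝ E3 - 1 = 2 := by
    rw [finrank_euclideanSpace_fin]
  rw [hdim, smul_eq_mul, sphereIntegral_def, ← integral_const_mul]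
  refine integral_congr_ae (ae_of_all _ fun α ↦ ?_)
  simp only
  rw [hhom _ (ne_zero_of_mem_unit_sphere α) r hr0, norm_smul_sphere hr0.le α, map_smul, smul_eq_mul]
  field_simp

/-- **`Σ_i ∂_i (κ zⁱ/|z|³) = (∫_{S²} κ dσ) δ₀`, weak form** (Mao–Oh–Tao, Remark 2.6, the identity at the origin):
for a profile `κ` continuous and `0`-homogeneous on `ℝ³ ∖ {0}` and a test function `φ ∈ C¹_c(ℝ³)`,
`∫ κ(z) |z|⁻³ Dφ(z)·z dz = −φ(0) ∫_{S²} κ dσ`, `σ = volume.toSphere` the surface measure of the unit sphere.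
[cite: MaoOhTao2023, Remark 2.6] -/
theorem integral_kernel_fderiv_apply_self_eq (hκ : ContinuousOn κ {0}ᶜ)
    (hhom : ∀ y : E3, y ≠ 0 → ∀ t : ℝ, 0 < t → κ (t • y) = κ y) (hφ : ContDiff ℝ 1 φ)
    (hφc : HasCompactSupport φ) :
    ∫ z : E3, κ z * ((‖z‖ ^ 3)⁻¹ * fderiv ℝ φ z z) =
      -(φ 0 * ∫ α, κ (α : E3) ∂(volume : Measure E3).toSphere) := by
  rw [integral_kernel_fderiv_apply_self_eq_integral_Ioi hκ hhom hφ hφc]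
  exact integral_Ioi_integral_weight_mul_fderiv (w := fun α ↦ κ (α : E3))
    (continuous_sphere_restrict hκ) hφ hφc

/-- **`Σ_i ∂_i (κ zⁱ/|z|³) = δ₀` for a normalised profile** (`∫_{S²} κ dσ = 1`, as in Lemma 2.5):
`∫ κ(z) |z|⁻³ Dφ(z)·z dz = −φ(0)` for `φ ∈ C¹_c(ℝ³)`. [cite: MaoOhTao2023, Lemma 2.5 (S_c2) and Remark 2.6] -/
theorem integral_kernel_fderiv_apply_self_eq_neg (hκ : ContinuousOn κ {0}ᶜ)
    (hhom : ∀ y : E3, y ≠ 0 → ∀ t : ℝ, 0 < t → κ (t • y) = κ y)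
    (hκ1 : ∫ α, κ (α : E3) ∂(volume : Measure E3).toSphere = 1) (hφ : ContDiff ℝ 1 φ)
    (hφc : HasCompactSupport φ) :
    ∫ z : E3, κ z * ((‖z‖ ^ 3)⁻¹ * fderiv ℝ φ z z) = -φ 0 := by
  rw [integral_kernel_fderiv_apply_self_eq hκ hhom hφ hφc, hκ1, mul_one]

/-- **Coordinate form**: `Σ_i ∫ κ(z) zᵢ/|z|³ ∂ᵢφ(z) dz = −φ(0) ∫_{S²} κ dσ`, i.e. the distribution
`Σ_i ∂_i (κ zⁱ/|z|³)` (whose action on `φ` is `−Σ_i ∫ κ zⁱ/|z|³ ∂ᵢφ`) is `(∫_{S²} κ dσ) δ₀`; each pairing is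
integrable (`integrable_kernel_mul`). [cite: MaoOhTao2023, Remark 2.6] -/
theorem sum_integral_kernel_coord_pd_eq (hκ : ContinuousOn κ {0}ᶜ)
    (hhom : ∀ y : E3, y ≠ 0 → ∀ t : ℝ, 0 < t → κ (t • y) = κ y) (hφ : ContDiff ℝ 1 φ)
    (hφc : HasCompactSupport φ) :
    ∑ i, ∫ z : E3, κ z * (z i * (‖z‖ ^ 3)⁻¹) * pd i φ z =
      -(φ 0 * ∫ α, κ (α : E3) ∂(volume : Measure E3).toSphere) := by
  have hint : ∀ i, Integrable fun z : E3 ↦ κ z * (z i * (‖z‖ ^ 3)⁻¹) * pd i φ z := fun i ↦ by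
    have hq : Continuous fun z : E3 ↦ z i * pd i φ z :=
      (EuclideanSpace.proj (𝕜 := ℝ) i).continuous.mul
        ((hφ.continuous_fderiv one_ne_zero).clm_apply continuous_const)
    have hqb : ∀ z : E3, |z i * pd i φ z| ≤ ‖z‖ * ‖fderiv ℝ φ z‖ := fun z ↦ by
      rw [abs_mul]
      refine mul_le_mul (abs_apply_le_norm z i) ?_ (abs_nonneg _) (norm_nonneg _)
      rw [pd, ← Real.norm_eq_abs]
      refine (ContinuousLinearMap.le_opNorm _ _).trans ?_
      rw [show ‖e i‖ = 1 by simp [e], mul_one]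
    refine (integrable_kernel_mul hκ hhom hφ hφc hq hqb).congr (Eventually.of_forall fun z ↦ ?_)
    simp only
    ring
  rw [← integral_finsetSum _ fun i _ ↦ hint i, ← integral_kernel_fderiv_apply_self_eq hκ hhom hφ hφc]
  refine integral_congr_ae (ae_of_all _ fun z ↦ ?_)
  simp only
  rw [fderiv_apply_self_eq_sum, Finset.mul_sum, Finset.mul_sum]
  exact Finset.sum_congr rfl fun i _ ↦ by ring

/-- **The paper's form `κ(z) = κ₀(z/|z|)`**: for a continuous profile `κ₀` (on `ℝ³`; only its values on the unit
sphere enter) and `φ ∈ C¹_c(ℝ³)`, `∫ κ₀(z/|z|) |z|⁻³ Dφ(z)·z dz = −φ(0) ∫_{S²} κ₀ dσ`.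
[cite: MaoOhTao2023, Lemma 2.5 (S_c2) and Remark 2.6] -/
theorem integral_kernel_fderiv_apply_self_eq_normalize {κ₀ : E3 → ℝ} (hκ₀ : Continuous κ₀)
    (hφ : ContDiff ℝ 1 φ) (hφc : HasCompactSupport φ) :
    ∫ z : E3, κ₀ (‖z‖⁻¹ • z) * ((‖z‖ ^ 3)⁻¹ * fderiv ℝ φ z z) =
      -(φ 0 * ∫ α, κ₀ (α : E3) ∂(volume : Measure E3).toSphere) := by
  have hκ : ContinuousOn (fun z : E3 ↦ κ₀ (‖z‖⁻¹ • z)) {0}ᶜ :=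
    hκ₀.comp_continuousOn ((continuousOn_inv₀.comp continuous_norm.continuousOn fun x hx ↦ by
      simpa using hx).smul continuousOn_id)
  rw [integral_kernel_fderiv_apply_self_eq hκ (fun _ hy _ ht ↦ comp_normalize_smul κ₀ hy ht) hφ hφc]
  congr 2
  refine integral_congr_ae (ae_of_all _ fun α ↦ ?_)
  simp only [norm_eq_of_mem_sphere α, inv_one, one_smul]

/-- **`div (z/|z|³) = 4π δ₀`** (the case `κ ≡ 1`: the flux of the Newtonian field through every sphere about the
origin is `4π`): `∫ |z|⁻³ Dφ(z)·z dz = −4π φ(0)` for `φ ∈ C¹_c(ℝ³)`. [folklore] -/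
theorem integral_inv_norm_cube_fderiv_apply_self_eq (hφ : ContDiff ℝ 1 φ) (hφc : HasCompactSupport φ) :
    ∫ z : E3, (‖z‖ ^ 3)⁻¹ * fderiv ℝ φ z z = -(4 * Real.pi * φ 0) := by
  have h := integral_kernel_fderiv_apply_self_eq (κ := fun _ ↦ (1 : ℝ)) continuousOn_const
    (fun _ _ _ _ ↦ rfl) hφ hφc
  simp only [one_mul] at h
  rw [h, integral_const, smul_eq_mul, mul_one, volume_toSphere_real_univ]
  ring

end Origin

/-! ### One-dimensional integration by parts on `(0, ∞)` -/

section RealLine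

/-- A continuous function vanishing on `(R, ∞)` is integrable on `(0, ∞)`. [folklore] -/
theorem integrableOn_Ioi_of_eq_zero_of_lt {f : ℝ → ℝ} (hf : Continuous f) {R : ℝ}
    (h0 : ∀ r, R < r → f r = 0) : IntegrableOn f (Ioi 0) := by
  have h1 : IntegrableOn f (Icc 0 (max R 0)) := hf.continuousOn.integrableOn_compact isCompact_Icc
  have h2 : IntegrableOn f (Ioi (max R 0)) :=
    integrableOn_zero.congr_fun (fun r hr ↦ (h0 r (lt_of_le_of_lt (le_max_left R 0) hr)).symm)
      measurableSet_Ioi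
  exact (h1.union h2).mono_set fun r hr ↦
    (le_or_gt r (max R 0)).elim (fun h ↦ Or.inl ⟨le_of_lt hr, h⟩) Or.inr

/-- **Integration by parts on `(0, ∞)` against `r`**: if `H` is differentiable with continuous derivative `H'`
and both vanish on `(R, ∞)`, then `∫_0^∞ r H'(r) dr = −∫_0^∞ H(r) dr` (the boundary term `[r H(r)]_0^∞`
vanishes). [folklore] -/
theorem integral_Ioi_mul_deriv_eq_neg_integral {H H' : ℝ → ℝ} (hH : ∀ r, HasDerivAt H (H' r) r)
    (hH'c : Continuous H') {R : ℝ} (hH0 : ∀ r, R < r → H r = 0) (hH'0 : ∀ r, R < r → H' r = 0) :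
    ∫ r in Ioi (0 : ℝ), r * H' r = -∫ r in Ioi (0 : ℝ), H r := by
  have hHc : Continuous H := continuous_iff_continuousAt.2 fun r ↦ (hH r).continuousAt
  have hP : ∀ r, HasDerivAt (fun ρ : ℝ ↦ ρ * H ρ) (H r + r * H' r) r := fun r ↦
    ((hasDerivAt_id' r).mul (hH r)).congr_deriv (by ring)
  have hsum0 : ∀ r, R < r → H r + r * H' r = 0 := fun r hr ↦ by
    rw [hH0 r hr, hH'0 r hr]; ring
  have hint : IntegrableOn (fun r ↦ H r + r * H' r) (Ioi 0) :=
    integrableOn_Ioi_of_eq_zero_of_lt (hHc.add (continuous_id.mul hH'c)) hsum0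
  have htends : Tendsto (fun ρ : ℝ ↦ ρ * H ρ) atTop (𝓝 0) := by
    refine tendsto_const_nhds.congr' ?_
    filter_upwards [eventually_gt_atTop R] with ρ hρ
    rw [hH0 ρ hρ, mul_zero]
  have key := integral_Ioi_of_hasDerivAt_of_tendsto (hP 0).continuousAt.continuousWithinAt
    (fun r _ ↦ hP r) hint htends
  have h1 : IntegrableOn H (Ioi 0) := integrableOn_Ioi_of_eq_zero_of_lt hHc hH0
  have h2 : IntegrableOn (fun r ↦ r * H' r) (Ioi 0) :=
    integrableOn_Ioi_of_eq_zero_of_lt (continuous_id.mul hH'c) fun r hr ↦ by rw [hH'0 r hr, mul_zero]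
  rw [integral_add h1 h2] at key
  simp only [zero_mul, sub_zero] at key
  linarith

end RealLine

/-! ### The second half of (S_c2): `Σ_{ij} ∫ K^{ij}_κ ∂_i∂_j ψ = (∫_{S²} κ) ψ(0)` -/

section SecondOrder

variable {κ ψ : E3 → ℝ}

/-- A uniform bound `|zᵢ Dg(z)·v| ≤ C |v|` for `g ∈ C¹_c` (on the support `|zᵢ| ≤ R`, and `Dg = 0` off it). [folklore] -/
theorem exists_bound_coord_mul_fderiv {g : E3 → ℝ} (hg : ContDiff ℝ 1 g) (hgc : HasCompactSupport g) :
    ∃ C, 0 ≤ C ∧ ∀ (z v : E3) (i : Fin 3), |z i * fderiv ℝ g z v| ≤ C * ‖v‖ := by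
  obtain ⟨R, hR⟩ := hgc.isCompact.isBounded.subset_closedBall 0
  obtain ⟨M, hM⟩ := (hg.continuous_fderiv one_ne_zero).bounded_above_of_compact_support
    (hgc.fderiv (𝕜 := ℝ))
  have hM0 : 0 ≤ M := (norm_nonneg _).trans (hM 0)
  refine ⟨max R 0 * M, mul_nonneg (le_max_right _ _) hM0, fun z v i ↦ ?_⟩
  by_cases hz : R < ‖z‖
  · rw [fderiv_eq_zero_of_lt_norm hR hz, show ((0 : E3 →L[ℝ] ℝ) v) = 0 from rfl, mul_zero, abs_zero]
    positivity
  · have hzR : ‖z‖ ≤ max R 0 := (not_lt.1 hz).trans (le_max_left _ _)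
    rw [abs_mul]
    calc |z i| * |fderiv ℝ g z v| ≤ max R 0 * (M * ‖v‖) := by
          refine mul_le_mul ((abs_apply_le_norm z i).trans hzR) ?_ (abs_nonneg _) (le_max_right _ _)
          rw [← Real.norm_eq_abs]
          exact (ContinuousLinearMap.le_opNorm _ _).trans (mul_le_mul_of_nonneg_right (hM z) (norm_nonneg _))
      _ = max R 0 * M * ‖v‖ := by ring

/-- **Polar form of the `K^{ij}_κ`-pairing.** For `g ∈ C¹_c(ℝ³)` and a fixed index `i`,
`∫ κ(z) zᵢ |z|⁻³ Dg(z)·z dz = ∫_0^∞ r (∫_{S²} κ(α) αᵢ Dg(rα)·α dσ(α)) dr`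
(`Σ_j K^{ij}_κ ∂_j g = κ zᵢ |z|⁻³ Dg·z = κ αᵢ |z|⁻¹ ∂_r g`; the integrand is `O(|z|⁻¹)` at the origin).
[cite: MaoOhTao2023, Remark 2.6] -/
theorem integral_conicKernel_fderiv_apply_self_eq_integral_Ioi (hκ : ContinuousOn κ {0}ᶜ)
    (hhom : ∀ y : E3, y ≠ 0 → ∀ t : ℝ, 0 < t → κ (t • y) = κ y) {g : E3 → ℝ} (hg : ContDiff ℝ 1 g)
    (hgc : HasCompactSupport g) (i : Fin 3) :
    ∫ z : E3, κ z * (z i * (‖z‖ ^ 3)⁻¹) * fderiv ℝ g z z =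
      ∫ r in Ioi (0 : ℝ), r * ∫ α, (κ (α : E3) * (α : E3) i) * fderiv ℝ g (r • (α : E3)) (α : E3)
        ∂(volume : Measure E3).toSphere := by
  obtain ⟨C, -, hC⟩ := exists_bound_coord_mul_fderiv hg hgc
  have hint : Integrable fun z : E3 ↦ κ z * ((‖z‖ ^ 3)⁻¹ * (z i * fderiv ℝ g z z)) := by
    refine integrable_kernel_mul_of_le hκ hhom ?_ ?_ (C := C) fun z ↦ hC z z i
    · exact (EuclideanSpace.proj (𝕜 := ℝ) i).continuous.mul
        ((hg.continuous_fderiv one_ne_zero).clm_apply continuous_id)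
    · refine (hgc.fderiv (𝕜 := ℝ)).mono (support_subset_iff'.2 fun z hz ↦ ?_)
      rw [notMem_support.1 hz]
      simp
  have heq : (fun z : E3 ↦ κ z * (z i * (‖z‖ ^ 3)⁻¹) * fderiv ℝ g z z) =
      fun z ↦ κ z * ((‖z‖ ^ 3)⁻¹ * (z i * fderiv ℝ g z z)) := by
    funext z; ring
  rw [heq, integral_eq_integral_Ioi_sphereIntegral (volume : Measure E3) hint]
  refine setIntegral_congr_fun measurableSet_Ioi fun r hr ↦ ?_
  have hr0 : (0 : ℝ) < r := hr
  have hdim : Module.finrank ℝ E3 - 1 = 2 := by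
    rw [finrank_euclideanSpace_fin]
  rw [hdim, smul_eq_mul, sphereIntegral_def, ← integral_const_mul, ← integral_const_mul]
  refine integral_congr_ae (ae_of_all _ fun α ↦ ?_)
  simp only [PiLp.smul_apply, smul_eq_mul]
  rw [hhom _ (ne_zero_of_mem_unit_sphere α) r hr0, norm_smul_sphere hr0.le α, map_smul, smul_eq_mul]
  field_simp

/-- **The `K^{ij}_κ`-pairing after the radial integration by parts**: for `g ∈ C¹_c(ℝ³)` and fixed `i`,
`∫ κ(z) zᵢ |z|⁻³ Dg(z)·z dz = −∫_0^∞ ∫_{S²} κ(α) αᵢ g(rα) dσ(α) dr`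
(`∫_0^∞ r H'(r) dr = −∫_0^∞ H` for the weighted sphere integral `H(r) = ∫ κ αᵢ g(rα) dσ`).
[cite: MaoOhTao2023, Remark 2.6] -/
theorem integral_conicKernel_fderiv_apply_self_eq_neg (hκ : ContinuousOn κ {0}ᶜ)
    (hhom : ∀ y : E3, y ≠ 0 → ∀ t : ℝ, 0 < t → κ (t • y) = κ y) {g : E3 → ℝ} (hg : ContDiff ℝ 1 g)
    (hgc : HasCompactSupport g) (i : Fin 3) :
    ∫ z : E3, κ z * (z i * (‖z‖ ^ 3)⁻¹) * fderiv ℝ g z z =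
      -∫ r in Ioi (0 : ℝ), ∫ α, (κ (α : E3) * (α : E3) i) * g (r • (α : E3))
        ∂(volume : Measure E3).toSphere := by
  rw [integral_conicKernel_fderiv_apply_self_eq_integral_Ioi hκ hhom hg hgc i]
  obtain ⟨R, hR⟩ := hgc.isCompact.isBounded.subset_closedBall 0
  have hw : Continuous fun α : sphere (0 : E3) 1 ↦ κ (α : E3) * (α : E3) i :=
    (continuous_sphere_restrict hκ).mul
      ((EuclideanSpace.proj (𝕜 := ℝ) i).continuous.comp continuous_subtype_val)
  refine integral_Ioi_mul_deriv_eq_neg_integral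
    (H := fun ρ : ℝ ↦ ∫ α, (κ (α : E3) * (α : E3) i) * g (ρ • (α : E3)) ∂(volume : Measure E3).toSphere)
    (fun r ↦ hasDerivAt_integral_weight_mul hw hg r) (continuous_integral_weight_mul_fderiv hw hg)
    (R := R) (fun r hr ↦ ?_) (fun r hr ↦ ?_)
  · have h : ∀ α : sphere (0 : E3) 1, g (r • (α : E3)) = 0 := fun α ↦
      eq_zero_of_lt_norm hR (by rw [norm_smul_unitSphere]; exact hr.trans_le (le_abs_self r))
    simp [h]
  · have h : ∀ α : sphere (0 : E3) 1, fderiv ℝ g (r • (α : E3)) = 0 := fun α ↦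
      fderiv_eq_zero_of_lt_norm hR (by rw [norm_smul_unitSphere]; exact hr.trans_le (le_abs_self r))
    simp [h]

/-- Each pairing `∫ K^{ij}_κ(z) ∂_j∂_iψ(z) dz` converges absolutely (`K^{ij}_κ = O(|z|⁻¹)`). [folklore] -/
theorem integrable_conicKernel_mul_pd_pd (hκ : ContinuousOn κ {0}ᶜ)
    (hhom : ∀ y : E3, y ≠ 0 → ∀ t : ℝ, 0 < t → κ (t • y) = κ y) (hψ : ContDiff ℝ 2 ψ)
    (hψc : HasCompactSupport ψ) (i j : Fin 3) :
    Integrable fun z : E3 ↦ κ z * (z i * (z j * (‖z‖ ^ 3)⁻¹)) * pd j (pd i ψ) z := by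
  have hg : ContDiff ℝ 1 (pd i ψ) := contDiff_pd (n := 1) hψ i
  have hgc : HasCompactSupport (pd i ψ) := hasCompactSupport_pd hψc i
  obtain ⟨C, hC0, hC⟩ := exists_bound_coord_mul_fderiv hg hgc
  have hint : Integrable fun z : E3 ↦ κ z * ((‖z‖ ^ 3)⁻¹ * (z i * (z j * pd j (pd i ψ) z))) := by
    refine integrable_kernel_mul_of_le hκ hhom ?_ ?_ (C := C) fun z ↦ ?_
    · exact (EuclideanSpace.proj (𝕜 := ℝ) i).continuous.mul
        ((EuclideanSpace.proj (𝕜 := ℝ) j).continuous.mul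
          ((hg.continuous_fderiv one_ne_zero).clm_apply continuous_const))
    · refine (hgc.fderiv_apply (𝕜 := ℝ) (e j)).mono (support_subset_iff'.2 fun z hz ↦ ?_)
      have h0 : fderiv ℝ (pd i ψ) z (e j) = 0 := notMem_support.1 hz
      simp only [pd] at h0 ⊢
      rw [h0]
      simp
    · rw [abs_mul]
      calc |z i| * |z j * pd j (pd i ψ) z| ≤ ‖z‖ * (C * ‖e j‖) :=
            mul_le_mul (abs_apply_le_norm z i) (hC z (e j) j) (abs_nonneg _) (norm_nonneg _)
        _ = C * ‖z‖ := by rw [show ‖e j‖ = 1 by simp [e]]; ring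
  refine hint.congr (Eventually.of_forall fun z ↦ ?_)
  simp only
  ring

/-- Per index `i`: `Σ_j ∫ K^{ij}_κ ∂_j∂_iψ = −∫_0^∞ ∫_{S²} κ(α) αᵢ ∂ᵢψ(rα) dσ dr`. [cite: MaoOhTao2023, Remark 2.6] -/
theorem sum_integral_conicKernel_pd_pd_eq_neg (hκ : ContinuousOn κ {0}ᶜ)
    (hhom : ∀ y : E3, y ≠ 0 → ∀ t : ℝ, 0 < t → κ (t • y) = κ y) (hψ : ContDiff ℝ 2 ψ)
    (hψc : HasCompactSupport ψ) (i : Fin 3) :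
    ∑ j, ∫ z : E3, κ z * (z i * (z j * (‖z‖ ^ 3)⁻¹)) * pd j (pd i ψ) z =
      -∫ r in Ioi (0 : ℝ), ∫ α, (κ (α : E3) * (α : E3) i) * pd i ψ (r • (α : E3))
        ∂(volume : Measure E3).toSphere := by
  have hg : ContDiff ℝ 1 (pd i ψ) := contDiff_pd (n := 1) hψ i
  have hgc : HasCompactSupport (pd i ψ) := hasCompactSupport_pd hψc i
  rw [← integral_conicKernel_fderiv_apply_self_eq_neg hκ hhom hg hgc i,
    ← integral_finsetSum _ fun j _ ↦ integrable_conicKernel_mul_pd_pd hκ hhom hψ hψc i j]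
  refine integral_congr_ae (ae_of_all _ fun z ↦ ?_)
  simp only
  rw [fderiv_apply_self_eq_sum, Finset.mul_sum]
  exact Finset.sum_congr rfl fun j _ ↦ by simp only [pd]; ring

/-- **(S_c2) for the conic Bogovskiĭ kernel, weak form** (Mao–Oh–Tao, Lemma 2.5 and Remark 2.6:
`∂_i∂_j (κ zⁱzʲ/|z|³) = (∫_{S²} κ) δ₀`): for a profile `κ` continuous and `0`-homogeneous on `ℝ³ ∖ {0}` and a test
function `ψ ∈ C²_c(ℝ³)`,
`Σ_{i,j} ∫ κ(z) zᵢ zⱼ |z|⁻³ ∂ⱼ∂ᵢψ(z) dz = ψ(0) ∫_{S²} κ dσ`.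
Proof as in Remark 2.6, in polar coordinates: the inner sum is `−∫_0^∞ ∫ κ αᵢ ∂ᵢψ(rα) dσ dr`
(`sum_integral_conicKernel_pd_pd_eq_neg`), and `Σ_i αᵢ ∂ᵢψ(rα) = (d/dr) ψ(rα)` integrates to `−ψ(0) ∫ κ`
(`integral_Ioi_integral_weight_mul_fderiv`). [cite: MaoOhTao2023, Lemma 2.5 (S_c2) and Remark 2.6] -/
theorem sum_sum_integral_conicKernel_pd_pd_eq (hκ : ContinuousOn κ {0}ᶜ)
    (hhom : ∀ y : E3, y ≠ 0 → ∀ t : ℝ, 0 < t → κ (t • y) = κ y) (hψ : ContDiff ℝ 2 ψ)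
    (hψc : HasCompactSupport ψ) :
    ∑ i, ∑ j, ∫ z : E3, κ z * (z i * (z j * (‖z‖ ^ 3)⁻¹)) * pd j (pd i ψ) z =
      ψ 0 * ∫ α, κ (α : E3) ∂(volume : Measure E3).toSphere := by
  have hψ1 : ContDiff ℝ 1 ψ := hψ.of_le one_le_two
  obtain ⟨R, hR⟩ := hψc.isCompact.isBounded.subset_closedBall 0
  rw [Finset.sum_congr rfl fun i _ ↦ sum_integral_conicKernel_pd_pd_eq_neg hκ hhom hψ hψc i,
    Finset.sum_neg_distrib]
  -- the radial integrands `H_i(r) = ∫ κ αᵢ ∂ᵢψ(rα) dσ` are continuous and vanish for `r > R`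
  have hw : ∀ i, Continuous fun α : sphere (0 : E3) 1 ↦ κ (α : E3) * (α : E3) i := fun i ↦
    (continuous_sphere_restrict hκ).mul
      ((EuclideanSpace.proj (𝕜 := ℝ) i).continuous.comp continuous_subtype_val)
  have hHint : ∀ i, IntegrableOn (fun r : ℝ ↦ ∫ α, (κ (α : E3) * (α : E3) i) * pd i ψ (r • (α : E3))
      ∂(volume : Measure E3).toSphere) (Ioi 0) := fun i ↦ by
    have hg : ContDiff ℝ 1 (pd i ψ) := contDiff_pd (n := 1) hψ i
    refine integrableOn_Ioi_of_eq_zero_of_lt (continuous_iff_continuousAt.2 fun r ↦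
      (hasDerivAt_integral_weight_mul (hw i) hg r).continuousAt) (R := R) fun r hr ↦ ?_
    have h : ∀ α : sphere (0 : E3) 1, pd i ψ (r • (α : E3)) = 0 := fun α ↦ by
      rw [pd, fderiv_eq_zero_of_lt_norm hR (by rw [norm_smul_unitSphere]; exact hr.trans_le (le_abs_self r))]
      rfl
    simp [h]
  rw [← integral_finsetSum _ fun i _ ↦ hHint i]
  -- `Σ_i κ αᵢ ∂ᵢψ(rα) = κ Dψ(rα)·α`
  have hG' : ∀ r : ℝ, ∑ i, (∫ α, (κ (α : E3) * (α : E3) i) * pd i ψ (r • (α : E3))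
      ∂(volume : Measure E3).toSphere) =
      ∫ α, κ (α : E3) * fderiv ℝ ψ (r • (α : E3)) (α : E3) ∂(volume : Measure E3).toSphere := by
    intro r
    have hi : ∀ i, Integrable (fun α : sphere (0 : E3) 1 ↦ (κ (α : E3) * (α : E3) i) * pd i ψ (r • (α : E3)))
        (volume : Measure E3).toSphere := fun i ↦ by
      have hc : Continuous fun α : sphere (0 : E3) 1 ↦ (κ (α : E3) * (α : E3) i) * pd i ψ (r • (α : E3)) :=
        (hw i).mul ((contDiff_pd (n := 1) hψ i).continuous.comp (continuous_subtype_val.const_smul r))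
      exact integrableOn_univ.1 (hc.continuousOn.integrableOn_compact isCompact_univ)
    rw [← integral_finsetSum _ fun i _ ↦ hi i]
    refine integral_congr_ae (ae_of_all _ fun α ↦ ?_)
    simp only
    rw [fderiv_apply_eq_sum ψ (r • (α : E3)) (α : E3), Finset.mul_sum]
    exact Finset.sum_congr rfl fun i _ ↦ by ring
  rw [setIntegral_congr_fun measurableSet_Ioi fun r _ ↦ hG' r,
    integral_Ioi_integral_weight_mul_fderiv (w := fun α ↦ κ (α : E3)) (continuous_sphere_restrict hκ) hψ1 hψc]
  ring

/-- **(S_c2), normalised profile**: if `∫_{S²} κ dσ = 1` then `Σ_{i,j} ∫ K^{ij}_κ ∂ⱼ∂ᵢψ = ψ(0)`, i.e.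
`∂_i∂_j K^{ij}_κ = δ₀` in `𝒟'(ℝ³)`. [cite: MaoOhTao2023, Lemma 2.5 (S_c2) and Remark 2.6] -/
theorem sum_sum_integral_conicKernel_pd_pd_eq_self (hκ : ContinuousOn κ {0}ᶜ)
    (hhom : ∀ y : E3, y ≠ 0 → ∀ t : ℝ, 0 < t → κ (t • y) = κ y)
    (hκ1 : ∫ α, κ (α : E3) ∂(volume : Measure E3).toSphere = 1) (hψ : ContDiff ℝ 2 ψ)
    (hψc : HasCompactSupport ψ) :
    ∑ i, ∑ j, ∫ z : E3, κ z * (z i * (z j * (‖z‖ ^ 3)⁻¹)) * pd j (pd i ψ) z = ψ 0 := by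
  rw [sum_sum_integral_conicKernel_pd_pd_eq hκ hhom hψ hψc, hκ1, mul_one]

/-- `∂_m (−h) = −∂_m h`. [folklore] -/
private theorem pd_neg (m : Fin 3) (h : E3 → ℝ) (x : E3) : pd m (fun y ↦ -h y) x = -pd m h x := by
  simp [pd]

/-- Chain rule through the reflection `y ↦ x − y`: `∂ᵢ[f(x − ·)](z) = −(∂ᵢf)(x − z)`. [folklore] -/
theorem pd_comp_const_sub {f : E3 → ℝ} (hf : Differentiable ℝ f) (x z : E3) (i : Fin 3) :
    pd i (fun y ↦ f (x - y)) z = -pd i f (x - z) := by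
  have h1 : HasFDerivAt (fun y : E3 ↦ x - y) ((0 : E3 →L[ℝ] E3) - ContinuousLinearMap.id ℝ E3) z :=
    (hasFDerivAt_const x z).sub (hasFDerivAt_id z)
  have h2 : fderiv ℝ (fun y ↦ f (x - y)) z =
      (fderiv ℝ f (x - z)).comp ((0 : E3 →L[ℝ] E3) - ContinuousLinearMap.id ℝ E3) :=
    ((hf (x - z)).hasFDerivAt.comp z h1).fderiv
  rw [pd, pd, h2]
  simp

/-- Second-order chain rule through the reflection: `∂ⱼ∂ᵢ[f(x − ·)](z) = (∂ⱼ∂ᵢf)(x − z)`. [folklore] -/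
theorem pd_pd_comp_const_sub {f : E3 → ℝ} (hf : ContDiff ℝ 2 f) (x z : E3) (i j : Fin 3) :
    pd j (pd i (fun y ↦ f (x - y))) z = pd j (pd i f) (x - z) := by
  have hfd : Differentiable ℝ f := hf.differentiable (by norm_num)
  have hpd : Differentiable ℝ (pd i f) := (contDiff_pd (n := 1) hf i).differentiable one_ne_zero
  have h1 : pd i (fun y ↦ f (x - y)) = fun y ↦ -pd i f (x - y) :=
    funext fun y ↦ pd_comp_const_sub hfd x y i
  rw [h1, pd_neg, pd_comp_const_sub hpd x z j, neg_neg]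

/-- **(S_c2) in convolution form.** For `f ∈ C²_c(ℝ³)` and every `x`,
`Σ_{i,j} ∫ K^{ij}_κ(z) (∂ⱼ∂ᵢ f)(x − z) dz = f(x) ∫_{S²} κ dσ`:
the double divergence of the convolution `(S_c f)^{ij} = K^{ij}_κ ⋆ f`, with the derivatives moved onto `f`, returns
`f` when `∫_{S²} κ = 1` (apply `sum_sum_integral_conicKernel_pd_pd_eq` to `ψ = f(x − ·)`).
[cite: MaoOhTao2023, Lemma 2.5 (S_c2) and Remark 2.6] -/
theorem sum_sum_integral_conicKernel_pd_pd_sub_eq (hκ : ContinuousOn κ {0}ᶜ)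
    (hhom : ∀ y : E3, y ≠ 0 → ∀ t : ℝ, 0 < t → κ (t • y) = κ y) {f : E3 → ℝ} (hf : ContDiff ℝ 2 f)
    (hfc : HasCompactSupport f) (x : E3) :
    ∑ i, ∑ j, ∫ z : E3, κ z * (z i * (z j * (‖z‖ ^ 3)⁻¹)) * pd j (pd i f) (x - z) =
      f x * ∫ α, κ (α : E3) ∂(volume : Measure E3).toSphere := by
  have hψ : ContDiff ℝ 2 (fun y : E3 ↦ f (x - y)) := hf.comp (contDiff_const.sub contDiff_id)
  obtain ⟨R, hR⟩ := hfc.isCompact.isBounded.subset_closedBall 0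
  have hψc : HasCompactSupport (fun y : E3 ↦ f (x - y)) := by
    refine HasCompactSupport.intro (isCompact_closedBall x R) fun y hy ↦ eq_zero_of_lt_norm hR ?_
    rw [mem_closedBall, not_le, dist_eq_norm] at hy
    rwa [← norm_neg, neg_sub]
  have key := sum_sum_integral_conicKernel_pd_pd_eq hκ hhom hψ hψc
  simp only [sub_zero] at key
  rw [← key]
  refine Finset.sum_congr rfl fun i _ ↦ Finset.sum_congr rfl fun j _ ↦ ?_
  refine integral_congr_ae (ae_of_all _ fun z ↦ ?_)
  simp only
  rw [pd_pd_comp_const_sub hf x z i j]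

/-- **(S_c2) in convolution form, normalised profile**: `Σ_{i,j} ∫ K^{ij}_κ(z) (∂ⱼ∂ᵢ f)(x − z) dz = f(x)` when
`∫_{S²} κ dσ = 1`. [cite: MaoOhTao2023, Lemma 2.5 (S_c2)] -/
theorem sum_sum_integral_conicKernel_pd_pd_sub_eq_self (hκ : ContinuousOn κ {0}ᶜ)
    (hhom : ∀ y : E3, y ≠ 0 → ∀ t : ℝ, 0 < t → κ (t • y) = κ y)
    (hκ1 : ∫ α, κ (α : E3) ∂(volume : Measure E3).toSphere = 1) {f : E3 → ℝ} (hf : ContDiff ℝ 2 f)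
    (hfc : HasCompactSupport f) (x : E3) :
    ∑ i, ∑ j, ∫ z : E3, κ z * (z i * (z j * (‖z‖ ^ 3)⁻¹)) * pd j (pd i f) (x - z) = f x := by
  rw [sum_sum_integral_conicKernel_pd_pd_sub_eq hκ hhom hf hfc x, hκ1, mul_one]

end SecondOrder

end MaoOhTao

end Literature.Geometry.Lorentzian

end
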